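import Summits.CriticalPhenomena.PercolationContinuityZ3.Theorems.FK.Transplant.KNFreeSlabCasesYX
import HarnessLib

/-!
# FRONTIER TRANSPLANT, binder 2 (TP_FK) — T4-SLAB (L9): case lemma X and the two DISPATCHERS of the lane router — outer lanes
# (exit on layer 1; cases O1/O23) and inner lanes (exit on layer `T`; cases X / T4 / Y-column, exhaustive)

Support file (`--supports stmt-CriticalPhenomena-4575`, helper) of the FRONTIER TRANSPLANT sub-cell (`fk-continuity/transplant/`,
seat `prim-bschramm-fkt-p1`); builds on p205010 (kernel theorem, internal audit signed; external expert review pending).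
0 definitions · 0 named facts · 0 sorries · standard axioms. File 11/18 of the bytes-first package (R60 (3)(β)) of the
UNFUNDED memo row `T4-SLAB [g122, R60]` (re-described R62 (E)); proposable only on a coordinator ruling.
Registered R63 (cell INBOX l.4709, 2026-08-23); registry row T4s; lead label T4s-11 (fkt-lead L22, l.4677).

HONEST FRAMING (page 1, cell rule). The transplant's theorem of record `ufsc0_of_freeBoundaryHypothesis_r3` (p248245) is
CONDITIONAL on FH AND on TP_FK = `KNFreeTargetHittable d q p`, both OPEN at the same `p` for `q > 1` near `p_c(q)` (⇔ GRC Conj.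
(5.103) via K1; barrier note `Literature.Barriers.CriticalPhenomena.SamePFreeBoundaryCriteria`, FBN-01, cited first); the
transplant is a typed reduction, not a proof of FK continuity. THIS FILE: case lemma `lane_caseX` and the two DISPATCHERS of the router — `outer_lane` (cases O1/O23) and
`inner_lane` (cases X / T4 / Y-column, exhaustive; gates supplied by a hypothesis that the gated collar meets,
`KNFreeSlabGates.exists_gate_foot`) — each returning, for an exit `z` of a sub-plate in the lane slab `{|x_c - ζ| ≤
L}`, a lane target `t ∈ v + ℓF`, a companion `w` (`= z` or not a neighbour of `z`) and the UNIFORM bound `γ =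
p̃^{T+2L+5}·β^{d m⋆}·β^{d m⋆} ≤ φ^free_R(z ↔ t in R)`, `R = (U ∩ slab) ∖ (S ∖ {z, w})`; `laneBound_le` compares the
per-case bounds with `γ`. It proves nothing about either binder and says nothing at `p ↓ p_c(q)`; NOT `_r4`; `_r3` « 2 / 0 ☑ », n_open = 2,
BINDER-OWNERS, FO-19 NO-GO unchanged.

Declarations: `lane_caseX`, `laneBound_le`, `outer_lane`, `inner_lane`.

References: G. Grimmett, *The Random-Cluster Model*, Springer 2006, Thm. (3.1) eq. (3.4), Thm. (3.7), Thm. (3.8), Thm. (3.21)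
eq. (3.22), Lemma (4.13), §5.7 [Grimmett2006]; G. Kozma, S. Nitzan, arXiv:2401.12397 (2024), §4 Lemma 10 Step IV (pp. 19–21) [KozmaNitzan2024].
-/

noncomputable section

namespace Summit.CriticalPhenomena.PercolationContinuityZ3.Theorems.FK

open MeasureTheory
open scoped ENNReal Classical
open Literature.Probability.Percolation Literature.Probability.LatticeModels SimpleGraph
open Literature.Probability.Percolation.GadgetSystem Literature.Probability.Percolation.KozmaNitzan Transplant
open Literature.Barriers.CriticalPhenomena

variable {d : ℕ}

/-- **Case X (inner, level box THIN in the contact direction): the far set reaches beyond the face `(i, -σ)` opposite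
to the contact by at least `2·Nbig + 1`.** Exit on layer `T`; interior slab box straight across to the gate foot
below the opposite face, gate column through that collar, face box beyond it; target
`t = (i ↦ far end of F, a ↦ c_a, b ↦ wf_b)`.
[cite: KozmaNitzan2024, §4 Lemma 10 Step IV (pp. 19–21); Grimmett2006, Thm. (3.1) eq. (3.4), Thm. (3.8), eq. (3.22), §5.7 eq. (5.102)] -/
theorem lane_caseX {q : ℝ} (hq : 1 ≤ q) (p : unitInterval) (hd : 3 ≤ d) {L : ℕ}
    {β : ℝ} (hβ0 : 0 ≤ β) (hβ1 : β ≤ 1)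
    (hβ : ∀ (N : ℕ) (g : zdGraph d ≃g zdGraph d) (u z : Site d), u ∈ fkSlab d L N → z ∈ fkSlab d L N →
      β ≤ (fkLaw ((fkSlab d L N).image g) (restrW (↑((fkSlab d L N).image g) : Set (Site d)) (lattW d p)) q).real
        (openConnIn (↑((fkSlab d L N).image g) : Set (Site d)) (g u) (g z)))
    (Lo Hi : Site d) (i : Fin d) (σ yi : ℤ) (hface : (σ = 1 ∧ yi = Hi i) ∨ (σ = -1 ∧ yi = Lo i))
    (M₀ M T G : ℕ) (hM₀ : M₀ + L + T + 2 ≤ M) (hGM : G ≤ M₀) (v : Site d)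
    (hvi : v i = yi - σ * ((M : ℤ) + 1))
    (hvb : ∀ b, b ≠ i → Lo b + M + 1 ≤ v b ∧ v b ≤ Hi b - M - 1)
    (S : Finset (Site d)) (hS : S ⊆ Finset.Icc (Lo + 1) (Hi - 1))
    (hSint : ∀ x ∈ S, x ∉ Finset.Icc (Lo + ((T : Site d) + 1)) (Hi - ((T : Site d) + 1)))
    (ℓ : ℕ) (g : Geom d) (hloQ : ∀ b, g.loQ b ≤ -1) (hhiQ : ∀ b, 1 ≤ g.hiQ b)
    (hFQ : ∀ b, g.loQ b ≤ g.loF b ∧ g.hiF b ≤ g.hiQ b) (hF : ∀ b, g.loF b ≤ g.hiF b)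
    (a : Fin d) (hF0 : ∀ b, b ≠ a → g.loF b ≤ 0 ∧ 0 ≤ g.hiF b) (hF1 : ∀ b, b ≠ a → g.loF b + 1 ≤ g.hiF b)
    (c : Fin d) (hci : c ≠ i) (hca : c ≠ a) (ζ : ℤ)
    (hζI : v c + ℓ * g.loF c ≤ ζ - L ∧ ζ + L ≤ v c + ℓ * g.hiF c) (hζv : |ζ - v c| ≤ M₀)
    (z : Site d) (hzi : z i = yi - σ * T) (hzc : z c = ζ) (hzv : ∀ b, b ≠ i → |z b - v b| ≤ M₀)
    (Nbig mstar : ℕ) (hLN : L ≤ Nbig) (hm3 : 4 ≤ mstar) (hℓ : (M : ℤ) + 2 * T + 2 * Nbig + 2 * L + 4 ≤ ℓ)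
    (hm : ∀ b, (ℓ : ℤ) * g.hiQ b - ℓ * g.loQ b + 2 * M + 2 ≤ (mstar : ℤ) * Nbig)
    (hfatX : ∀ b, b ≠ c → b ≠ i → Lo b + 2 * M + 2 * T + 2 * Nbig + 4 ≤ Hi b)
    -- the case: thin in `i` (far set beyond the opposite face by `≥ 2 Nbig + 1`), wide enough for the window
    (hthin : Hi i - Lo i ≤ ℓ + M - 2 * Nbig) (hwidei : Lo i + 4 * M + 4 ≤ Hi i)
    (hXF : (σ = 1 → g.loF i ≤ -1) ∧ (σ = -1 → 1 ≤ g.hiF i))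
    -- gate availability on the face `(i, -σ)` inside the slab
    (hgateI : ∀ r : Site d, (∀ b, b ≠ i → b ≠ c → Lo b + T + 1 ≤ r b ∧ r b + G ≤ Hi b - T - 1) →
      ∃ wf : Site d, wf i = (if σ = 1 then Lo i else Hi i) - (-σ) * ((T : ℤ) + 1) ∧ |wf c - ζ| ≤ (L : ℤ) ∧
        (∀ b, b ≠ i → b ≠ c → r b ≤ wf b ∧ wf b ≤ r b + G) ∧
        (∀ j : ℕ, 1 ≤ j → j + 1 ≤ T →
          Function.update wf i ((if σ = 1 then Lo i else Hi i) - (-σ) * ((T : ℤ) + 1) + (-σ) * j) ∉ S)) :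
    ∃ t w : Site d, t ∈ g.Fset ℓ v ∧ (z = w ∨ ¬ (zdGraph d).Adj z w) ∧
      ((p : ℝ) / (p + q * (1 - p))) ^ (T + 2 * L + 5) * β ^ (d * mstar) * β ^ (d * mstar) ≤
        (fkLaw (((g.Qset ℓ v).filter fun x => |x c - ζ| ≤ (L : ℤ)) \ (S \ {z, w}))
          (restrW (↑(((g.Qset ℓ v).filter fun x => |x c - ζ| ≤ (L : ℤ)) \ (S \ {z, w})) : Set (Site d))
            (lattW d p)) q).real
        (openConnIn (↑(((g.Qset ℓ v).filter fun x => |x c - ζ| ≤ (L : ℤ)) \ (S \ {z, w})) : Set (Site d)) z t) := by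
  have hq0 : 0 < q := one_pos.trans_le hq
  have hℓ0 : (0 : ℤ) ≤ ℓ := Nat.cast_nonneg ℓ
  have hA : ∀ b, (ℓ : ℤ) * g.loQ b ≤ -ℓ := fun b => by
    have := mul_le_mul_of_nonneg_left (hloQ b) hℓ0; linarith
  have hB : ∀ b, (ℓ : ℤ) ≤ ℓ * g.hiQ b := fun b => by
    have := mul_le_mul_of_nonneg_left (hhiQ b) hℓ0; linarith
  have hAF : ∀ b, (ℓ : ℤ) * g.loQ b ≤ ℓ * g.loF b := fun b => mul_le_mul_of_nonneg_left (hFQ b).1 hℓ0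
  have hFF : ∀ b, (ℓ : ℤ) * g.loF b ≤ ℓ * g.hiF b := fun b => mul_le_mul_of_nonneg_left (hF b) hℓ0
  have hFB : ∀ b, (ℓ : ℤ) * g.hiF b ≤ ℓ * g.hiQ b := fun b => mul_le_mul_of_nonneg_left (hFQ b).2 hℓ0
  have hM₀' : (M₀ : ℤ) + L + T + 2 ≤ M := by exact_mod_cast hM₀
  have hGM' : (G : ℤ) ≤ M₀ := by exact_mod_cast hGM
  have hL0 : (0 : ℤ) ≤ L := Nat.cast_nonneg L
  have hT0 : (0 : ℤ) ≤ T := Nat.cast_nonneg T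
  have hm1 : 1 ≤ mstar := by omega
  have hNℓ' : (Nbig : ℤ) ≤ ℓ := by linarith
  have hNℓ : Nbig ≤ ℓ := by exact_mod_cast hNℓ'
  have hσ1 : σ = 1 ∨ σ = -1 := hface.elim (fun h => Or.inl h.1) (fun h => Or.inr h.1)
  have hXF' : (σ = 1 → (ℓ : ℤ) * g.loF i ≤ -ℓ) ∧ (σ = -1 → (ℓ : ℤ) ≤ ℓ * g.hiF i) :=
    ⟨fun h => by have := mul_le_mul_of_nonneg_left (hXF.1 h) hℓ0; linarith,
     fun h => by have := mul_le_mul_of_nonneg_left (hXF.2 h) hℓ0; linarith⟩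
  -- the interior unit `N`
  have hmi := hm i
  obtain ⟨N, hLN', hNN, hNW, hWN, hMGN⟩ := exists_interior_unit L Nbig mstar M₀ G (Hi i - Lo i - 2 * T - 2) hm3 hLN
    (by linarith) (by linarith [hA i, hB i])
  -- the interior frame (thin variant)
  obtain ⟨hzQ, hfat, hslabQ, hslabIn, hx1, hx1v, hvIn, hUi⟩ := inner_frame_X Lo Hi i σ yi hface M₀ M T L (by omega) v hvi
    hvb ℓ g hloQ hhiQ c hci ζ hζv z hzi hzv Nbig N hNN hℓ hfatX (by linarith) (by linarith) (by linarith)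
  -- the `i`-arithmetic of the column face `(i, -σ)`, the face box beyond it and the target's `i`-coordinate
  obtain ⟨hfaceF, ⟨hfi1, hfi2⟩, ⟨hfiQ1, hfiQ2⟩, hdisti, hzwi, haFQ, hbFQ, hFout, hxB, hFN, htIB, htIF, hdtI⟩ :=
    caseX_i_facts Lo Hi v i σ yi hface M T (by omega) hvi ℓ (ℓ * g.loQ i) (ℓ * g.hiQ i) (ℓ * g.loF i) (ℓ * g.hiF i)
      (hA i) (hB i) (hAF i) (hFF i) (hFB i) hXF' Nbig mstar hmi hthin (by linarith)
  -- the gate foot `wf`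
  obtain ⟨wf, hwfi, hwfcL, hwfr, hgate⟩ := hgateI (fun b => if 1 ≤ g.hiF b then v b else v b - G) (by
    intro b _ _
    have := hvIn b
    by_cases h1 : 1 ≤ g.hiF b
    · simp only [if_pos h1]; constructor <;> linarith
    · simp only [if_neg h1]; constructor <;> linarith)
  obtain ⟨hwin, hwfF, hwfI, hdist⟩ := X_wf_facts Lo Hi i M₀ M T G hGM (by omega) v hvIn ℓ g hloQ hhiQ (by linarith) a
    hF0 hF1 c z hzv (yi - σ * ((T : ℤ) + 1)) N mstar hMGN wf _ hwfi hfi1 hfi2 hfiQ1 hfiQ2 (hdisti.trans hWN) hwfr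
  have hwfc := abs_le.1 hwfcL
  -- the second frozen vertex and the target
  set w := Function.update wf i ((if σ = 1 then Lo i else Hi i) - (-σ)) with hw
  have hzw : z = w ∨ ¬ (zdGraph d).Adj z w := by
    refine Or.inr (not_adj_of_two_le_abs i ?_)
    rw [hw, Function.update_self, hzi]; exact hzwi
  set tI : ℤ := if σ = 1 then v i + ℓ * g.loF i else v i + ℓ * g.hiF i with htI
  set t : Site d := Function.update (Function.update wf a (v a + ℓ * g.loF a)) i tI with htdef
  have hti : t i = tI := by rw [htdef, Function.update_self]
  have hta : a ≠ i → t a = v a + ℓ * g.loF a := fun h => by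
    rw [htdef, Function.update_of_ne h, Function.update_self]
  have htb : ∀ b, b ≠ i → b ≠ a → t b = wf b := fun b hbi hba => by
    rw [htdef, Function.update_of_ne hbi, Function.update_of_ne hba]
  have htF : t ∈ g.Fset ℓ v := by
    rw [Geom.Fset, mem_Icc_iff]
    intro b
    simp only [Pi.add_apply, Pi.smul_apply, smul_eq_mul]
    by_cases hbi : b = i
    · rw [hbi, hti]; exact htIF
    · by_cases hba : b = a
      · rw [hba, hta (hba ▸ hbi)]; exact ⟨le_rfl, by linarith [hFF a]⟩
      · rw [htb b hbi hba]
        by_cases hbc : b = c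
        · rw [hbc]; constructor <;> linarith [hζI.1, hζI.2, hwfc.1, hwfc.2]
        · exact hwfF b hbi hbc hba
  refine ⟨t, w, htF, hzw, ?_⟩
  have hπ0 : 0 ≤ (p : ℝ) / (p + q * (1 - p)) := div_nonneg p.2.1 (by nlinarith [p.2.1, p.2.2, hq0])
  have hπ1 : (p : ℝ) / (p + q * (1 - p)) ≤ 1 := by
    rw [div_le_one (by nlinarith [p.2.1, p.2.2, hq0])]; nlinarith [p.2.1, p.2.2, hq0]
  have h := inner_column_faceBox_route hq p hd hβ0 hβ1 hβ Lo Hi i σ yi hface T v S hS hSint ℓ g hloQ hhiQ c hci z ζ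
    hzi hzc hzQ N mstar hLN' hm1 hfat hslabQ hslabIn hx1 i hci.symm (-σ) _ hfaceF wf hwfi hwfcL hwfI hdist hgate
    _ _ haFQ hbFQ hFout hxB Nbig mstar hFN hNℓ hLN t
    (by rw [htb c hci hca]; constructor <;> linarith [hwfc.1, hwfc.2])
    (by rw [hti]; exact htIB)
    (fun b hbc hbi => by
      by_cases hba : b = a
      · rw [hba, hta (hba ▸ hbi)]; exact ⟨by linarith [hAF a], by linarith [hFF a, hFB a]⟩
      · rw [htb b hbi hba]; have := hwin b hbi hbc; constructor <;> linarith [hA b, hB b])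
    (fun b hbc hbi => by
      by_cases hba : b = a
      · rw [hba, hta (hba ▸ hbi)]
        have := hwin a (hba ▸ hbi) (hba ▸ hbc); have hma := hm a
        rw [abs_le]; constructor <;> linarith [hAF a, hFF a, hFB a, hA a, hB a]
      · rw [htb b hbi hba, sub_self, abs_zero]; positivity)
    (by rw [hti]; exact hdtI)
    (by rw [htb c hci hca, sub_self, abs_zero]; positivity)
  refine le_trans ?_ h
  have hT' : T + 3 ≤ T + 2 * L + 5 := by omega
  exact mul_le_mul_of_nonneg_right (mul_le_mul_of_nonneg_right (pow_le_pow_of_le_one hπ0 hπ1 hT')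
    (pow_nonneg hβ0 _)) (pow_nonneg hβ0 _)


/-! ### (P1) v5 — THE TWO DISPATCHERS: outer lanes (exit on layer 1) and inner lanes (exit on layer `T`)

The uniform lane bound is `γ = p̃^{T+2L+5} · β^{d·mstar} · β^{d·mstar}` (a lower bound of every case's bound, since
`p̃, β ≤ 1`). `outer_lane` serves the contacts of the OUTER cases O1/O23 (decided by the geometry before the shell is
revealed), `inner_lane` all others (cases X / T4 / Y-column, exhaustively). -/

/-- Weakening a route bound to the uniform lane bound. [folklore] -/
theorem laneBound_le {π β : ℝ} (hπ0 : 0 ≤ π) (hπ1 : π ≤ 1) (hβ0 : 0 ≤ β) (hβ1 : β ≤ 1) {e e' k k₁ k₂ : ℕ}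
    (he : e ≤ e') (h1 : k₁ ≤ k) (h2 : k₂ ≤ k) :
    π ^ e' * β ^ k * β ^ k ≤ π ^ e * β ^ k₁ * β ^ k₂ :=
  mul_le_mul (mul_le_mul (pow_le_pow_of_le_one hπ0 hπ1 he) (pow_le_pow_of_le_one hβ0 hβ1 h1) (pow_nonneg hβ0 _)
    (pow_nonneg hπ0 _)) (pow_le_pow_of_le_one hβ0 hβ1 h2) (pow_nonneg hβ0 _)
    (mul_nonneg (pow_nonneg hπ0 _) (pow_nonneg hβ0 _))

/-- **Outer lanes.** For a contact whose geometry is in case O1 (the far set reaches beyond the contact's face) or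
O23 (the look box sticks out, inside `F`'s range, beyond a face `(f, τf)` with `f ∉ {i, c}`): from the exit `z` on
layer 1 of the lane slab there is a target `t ∈ v + ℓF_g` with `γ ≤ φ^free_R(z ↔ t in R)`,
`R = (U ∩ slab) ∖ (S ∖ {z, w})`, `w = z`.
[cite: KozmaNitzan2024, §4 Lemma 10 Step IV (pp. 19–21); Grimmett2006, Thm. (3.1) eq. (3.4), Thm. (3.8), eq. (3.22), §5.7 eq. (5.102)] -/
theorem outer_lane {q : ℝ} (hq : 1 ≤ q) (p : unitInterval) (hd : 3 ≤ d) {L : ℕ}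
    {β : ℝ} (hβ0 : 0 ≤ β) (hβ1 : β ≤ 1)
    (hβ : ∀ (N : ℕ) (g : zdGraph d ≃g zdGraph d) (u z : Site d), u ∈ fkSlab d L N → z ∈ fkSlab d L N →
      β ≤ (fkLaw ((fkSlab d L N).image g) (restrW (↑((fkSlab d L N).image g) : Set (Site d)) (lattW d p)) q).real
        (openConnIn (↑((fkSlab d L N).image g) : Set (Site d)) (g u) (g z)))
    (Lo Hi : Site d) (i : Fin d) (σ yi : ℤ) (hface : (σ = 1 ∧ yi = Hi i) ∨ (σ = -1 ∧ yi = Lo i))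
    (M₀ M T : ℕ) (hM₀ : M₀ ≤ M) (v : Site d) (hvi : v i = yi - σ * ((M : ℤ) + 1))
    (hvb : ∀ b, b ≠ i → Lo b + M + 1 ≤ v b ∧ v b ≤ Hi b - M - 1)
    (S : Finset (Site d)) (hS : S ⊆ Finset.Icc (Lo + 1) (Hi - 1))
    (ℓ : ℕ) (g : Geom d) (hloQ : ∀ b, g.loQ b ≤ -1) (hhiQ : ∀ b, 1 ≤ g.hiQ b)
    (hFQ : ∀ b, g.loQ b ≤ g.loF b ∧ g.hiF b ≤ g.hiQ b) (hF : ∀ b, g.loF b ≤ g.hiF b)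
    (c : Fin d) (hci : c ≠ i) (ζ : ℤ) (hζI : v c + ℓ * g.loF c ≤ ζ ∧ ζ ≤ v c + ℓ * g.hiF c) (hζv : |ζ - v c| ≤ M₀)
    (z : Site d) (hzi : z i = yi - σ) (hzc : z c = ζ) (hzv : ∀ b, b ≠ i → |z b - v b| ≤ M₀)
    (Nbig mstar : ℕ) (hLN : L ≤ Nbig) (hℓ : (M : ℤ) + 2 * L + 2 * Nbig + 2 ≤ ℓ)
    (hm : ∀ b, (ℓ : ℤ) * g.hiQ b - ℓ * g.loQ b + 2 * M + 2 ≤ (mstar : ℤ) * Nbig)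
    (hOuter : ((σ = 1 ∧ 1 ≤ g.hiF i) ∨ (σ = -1 ∧ g.loF i ≤ -1)) ∨
      ∃ (f : Fin d) (τf yf : ℤ), f ≠ i ∧ f ≠ c ∧ ((τf = 1 ∧ yf = Hi f) ∨ (τf = -1 ∧ yf = Lo f)) ∧
        (τf = 1 → yf + 2 * Nbig + 2 ≤ v f + ℓ * g.hiF f) ∧ (τf = -1 → v f + ℓ * g.loF f + 2 * Nbig + 2 ≤ yf)) :
    ∃ t w : Site d, t ∈ g.Fset ℓ v ∧ (z = w ∨ ¬ (zdGraph d).Adj z w) ∧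
      ((p : ℝ) / (p + q * (1 - p))) ^ (T + 2 * L + 5) * β ^ (d * mstar) * β ^ (d * mstar) ≤
        (fkLaw (((g.Qset ℓ v).filter fun x => |x c - ζ| ≤ (L : ℤ)) \ (S \ {z, w}))
          (restrW (↑(((g.Qset ℓ v).filter fun x => |x c - ζ| ≤ (L : ℤ)) \ (S \ {z, w})) : Set (Site d))
            (lattW d p)) q).real
        (openConnIn (↑(((g.Qset ℓ v).filter fun x => |x c - ζ| ≤ (L : ℤ)) \ (S \ {z, w})) : Set (Site d)) z t) := by
  have hq0 : 0 < q := one_pos.trans_le hq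
  have hπ0 : 0 ≤ (p : ℝ) / (p + q * (1 - p)) := div_nonneg p.2.1 (by nlinarith [p.2.1, p.2.2, hq0])
  have hπ1 : (p : ℝ) / (p + q * (1 - p)) ≤ 1 := by
    rw [div_le_one (by nlinarith [p.2.1, p.2.2, hq0])]; nlinarith [p.2.1, p.2.2, hq0]
  rcases hOuter with hO1 | ⟨f, τf, yf, hfi, hfc, hfaceF, hO23⟩
  · obtain ⟨t, w, htF, hzw, h⟩ := lane_caseO1 hq p hd hβ0 hβ1 hβ Lo Hi i σ yi hface M₀ M hM₀ v hvi S hS ℓ g hloQ hhiQ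
      hFQ hF c hci ζ hζI hζv z hzi hzc hzv Nbig mstar hLN hℓ hm hO1
    refine ⟨t, w, htF, hzw, le_trans ?_ h⟩
    calc ((p : ℝ) / (p + q * (1 - p))) ^ (T + 2 * L + 5) * β ^ (d * mstar) * β ^ (d * mstar)
        ≤ ((p : ℝ) / (p + q * (1 - p))) ^ 2 * β ^ (d * mstar) * β ^ 0 :=
          laneBound_le hπ0 hπ1 hβ0 hβ1 (by omega) le_rfl (Nat.zero_le _)
      _ = _ := by rw [pow_zero, mul_one]
  · obtain ⟨t, w, htF, hzw, h⟩ := lane_caseO23 hq p hd hβ0 hβ1 hβ Lo Hi i σ yi hface M₀ M hM₀ v hvi hvb S hS ℓ g hloQ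
      hhiQ hFQ hF c hci ζ hζI hζv z hzi hzc hzv Nbig mstar hLN hℓ hm f hfi hfc τf yf hfaceF hO23
    exact ⟨t, w, htF, hzw, le_trans (laneBound_le hπ0 hπ1 hβ0 hβ1 (by omega) le_rfl le_rfl) h⟩

/-- **Inner lanes.** For a contact NOT in the outer cases — encoded by: `F` does not reach beyond the contact's face
(`hnotO1`), the level box is fat in every direction `b ∉ {i, c}` (`hfatX`, consequence of ¬O23 and the shape), and
`F`'s flat coordinate is within `2·Nbig + 1` of the level box in direction `a` when `a ≠ i` (`hnear`) — and with
gates available on the faces of directions `i` and `a`: from the exit `z` on layer `T` of the lane slab there are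
`t ∈ v + ℓF_g` and `w` (`= z` or not a neighbour of `z`) with `γ ≤ φ^free_R(z ↔ t in R)`,
`R = (U ∩ slab) ∖ (S ∖ {z, w})`. Cases: X (thin in `i`), T4 (`c_a` interior), Y-column (else) — exhaustive.
[cite: KozmaNitzan2024, §4 Lemma 10 Step IV (pp. 19–21); Grimmett2006, Thm. (3.1) eq. (3.4), Thm. (3.8), eq. (3.22), §5.7 eq. (5.102)] -/
theorem inner_lane {q : ℝ} (hq : 1 ≤ q) (p : unitInterval) (hd : 3 ≤ d) {L : ℕ}
    {β : ℝ} (hβ0 : 0 ≤ β) (hβ1 : β ≤ 1)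
    (hβ : ∀ (N : ℕ) (g : zdGraph d ≃g zdGraph d) (u z : Site d), u ∈ fkSlab d L N → z ∈ fkSlab d L N →
      β ≤ (fkLaw ((fkSlab d L N).image g) (restrW (↑((fkSlab d L N).image g) : Set (Site d)) (lattW d p)) q).real
        (openConnIn (↑((fkSlab d L N).image g) : Set (Site d)) (g u) (g z)))
    (Lo Hi : Site d) (i : Fin d) (σ yi : ℤ) (hface : (σ = 1 ∧ yi = Hi i) ∨ (σ = -1 ∧ yi = Lo i))
    (M₀ M T G : ℕ) (hM₀ : M₀ + L + T + 2 ≤ M) (hGM : G ≤ M₀) (v : Site d)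
    (hvi : v i = yi - σ * ((M : ℤ) + 1))
    (hvb : ∀ b, b ≠ i → Lo b + M + 1 ≤ v b ∧ v b ≤ Hi b - M - 1) (hwide4 : ∀ b, Lo b + 4 * M + 4 ≤ Hi b)
    (S : Finset (Site d)) (hS : S ⊆ Finset.Icc (Lo + 1) (Hi - 1))
    (hSint : ∀ x ∈ S, x ∉ Finset.Icc (Lo + ((T : Site d) + 1)) (Hi - ((T : Site d) + 1)))
    (ℓ : ℕ) (g : Geom d) (hloQ : ∀ b, g.loQ b ≤ -1) (hhiQ : ∀ b, 1 ≤ g.hiQ b)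
    (hFQ : ∀ b, g.loQ b ≤ g.loF b ∧ g.hiF b ≤ g.hiQ b) (hF : ∀ b, g.loF b ≤ g.hiF b)
    (a : Fin d) (hflat : g.loF a = g.loQ a ∨ g.hiF a = g.hiQ a)
    (hF0 : ∀ b, b ≠ a → g.loF b ≤ 0 ∧ 0 ≤ g.hiF b) (hF1 : ∀ b, b ≠ a → g.loF b + 1 ≤ g.hiF b)
    (c : Fin d) (hci : c ≠ i) (hca : c ≠ a) (ζ : ℤ)
    (hζI : v c + ℓ * g.loF c ≤ ζ - L ∧ ζ + L ≤ v c + ℓ * g.hiF c) (hζv : |ζ - v c| ≤ M₀)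
    (z : Site d) (hzi : z i = yi - σ * T) (hzc : z c = ζ) (hzv : ∀ b, b ≠ i → |z b - v b| ≤ M₀)
    (Nbig mstar : ℕ) (hLN : L ≤ Nbig) (hm3 : 4 ≤ mstar) (hℓ : (M : ℤ) + 2 * T + 4 * Nbig + 2 * L + 4 ≤ ℓ)
    (hm : ∀ b, (ℓ : ℤ) * g.hiQ b - ℓ * g.loQ b + 2 * M + 2 ≤ (mstar : ℤ) * Nbig)
    -- not an outer case
    (hnotO1 : (σ = 1 → g.hiF i ≤ 0) ∧ (σ = -1 → 0 ≤ g.loF i))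
    (hfatX : ∀ b, b ≠ c → b ≠ i → Lo b + 2 * M + 2 * T + 2 * Nbig + 4 ≤ Hi b)
    -- gate availability on every face of directions `i` and `a`, inside the slab
    (hgate : ∀ f : Fin d, (f = i ∨ f = a) → ∀ τf yf : ℤ, ((τf = 1 ∧ yf = Hi f) ∨ (τf = -1 ∧ yf = Lo f)) →
      ∀ r : Site d, (∀ b, b ≠ f → b ≠ c → Lo b + T + 1 ≤ r b ∧ r b + G ≤ Hi b - T - 1) →
      ∃ wf : Site d, wf f = yf - τf * ((T : ℤ) + 1) ∧ |wf c - ζ| ≤ (L : ℤ) ∧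
        (∀ b, b ≠ f → b ≠ c → r b ≤ wf b ∧ wf b ≤ r b + G) ∧
        (∀ j : ℕ, 1 ≤ j → j + 1 ≤ T → Function.update wf f (yf - τf * ((T : ℤ) + 1) + τf * j) ∉ S)) :
    ∃ t w : Site d, t ∈ g.Fset ℓ v ∧ (z = w ∨ ¬ (zdGraph d).Adj z w) ∧
      ((p : ℝ) / (p + q * (1 - p))) ^ (T + 2 * L + 5) * β ^ (d * mstar) * β ^ (d * mstar) ≤
        (fkLaw (((g.Qset ℓ v).filter fun x => |x c - ζ| ≤ (L : ℤ)) \ (S \ {z, w}))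
          (restrW (↑(((g.Qset ℓ v).filter fun x => |x c - ζ| ≤ (L : ℤ)) \ (S \ {z, w})) : Set (Site d))
            (lattW d p)) q).real
        (openConnIn (↑(((g.Qset ℓ v).filter fun x => |x c - ζ| ≤ (L : ℤ)) \ (S \ {z, w})) : Set (Site d)) z t) := by
  have hq0 : 0 < q := one_pos.trans_le hq
  have hπ0 : 0 ≤ (p : ℝ) / (p + q * (1 - p)) := div_nonneg p.2.1 (by nlinarith [p.2.1, p.2.2, hq0])
  have hπ1 : (p : ℝ) / (p + q * (1 - p)) ≤ 1 := by
    rw [div_le_one (by nlinarith [p.2.1, p.2.2, hq0])]; nlinarith [p.2.1, p.2.2, hq0]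
  have hℓ0 : (0 : ℤ) ≤ ℓ := Nat.cast_nonneg ℓ
  have hN0 : (0 : ℤ) ≤ Nbig := Nat.cast_nonneg Nbig
  have hℓ' : (M : ℤ) + 2 * T + 2 * Nbig + 2 * L + 4 ≤ ℓ := by linarith
  have hM₀' : (M₀ : ℤ) + L + T + 2 ≤ M := by exact_mod_cast hM₀
  rcases le_or_gt (Hi i - Lo i) ((ℓ : ℤ) + M - 2 * Nbig) with hthin | hfat_i
  · -- case X: thin in `i`
    have hXF : (σ = 1 → g.loF i ≤ -1) ∧ (σ = -1 → 1 ≤ g.hiF i) := by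
      constructor
      · intro hσ
        have h0 := hnotO1.1 hσ
        by_cases hai : i = a
        · rw [hai] at h0 ⊢
          rcases hflat with h | h
          · rw [h]; exact hloQ a
          · exfalso; have := hhiQ a; rw [← h] at this; linarith
        · have := hF1 i hai; have := (hF0 i hai).2; omega
      · intro hσ
        have h0 := hnotO1.2 hσ
        by_cases hai : i = a
        · rw [hai] at h0 ⊢
          rcases hflat with h | h
          · exfalso; have := hloQ a; rw [← h] at this; linarith
          · rw [h]; exact hhiQ a
        · have := hF1 i hai; have := (hF0 i hai).1; omega
    have hfaceI : ((-σ = 1 ∧ (if σ = 1 then Lo i else Hi i) = Hi i) ∨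
        (-σ = -1 ∧ (if σ = 1 then Lo i else Hi i) = Lo i)) := by
      rcases hface with ⟨hσ, -⟩ | ⟨hσ, -⟩
      · right; rw [hσ]; simp
      · left; rw [hσ]; norm_num
    obtain ⟨t, w, htF, hzw, h⟩ := lane_caseX hq p hd hβ0 hβ1 hβ Lo Hi i σ yi hface M₀ M T G hM₀ hGM v hvi hvb S hS
      hSint ℓ g hloQ hhiQ hFQ hF a hF0 hF1 c hci hca ζ hζI hζv z hzi hzc hzv Nbig mstar hLN hm3 hℓ' hm hfatX hthin
      (hwide4 i) hXF (hgate i (Or.inl rfl) (-σ) _ hfaceI)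
    exact ⟨t, w, htF, hzw, h⟩
  · -- fat in `i` too: every direction `b ≠ c` is fat
    have hfatX' : ∀ b, b ≠ c → Lo b + 2 * M + 2 * T + 2 * Nbig + 4 ≤ Hi b := by
      intro b hbc
      by_cases hbi : b = i
      · rw [hbi]; linarith
      · exact hfatX b hbc hbi
    set ca : ℤ := v a + ℓ * g.loF a with hca_def
    rcases le_or_gt (Lo a + T + 1) ca with hlo | hlo
    · rcases le_or_gt ca (Hi a - T - 1) with hhi | hhi
      · -- case T4: `c_a` in the interior range
        obtain ⟨t, w, htF, hzw, h⟩ := lane_caseT4 hq p hd hβ0 hβ1 hβ Lo Hi i σ yi hface M₀ M T (by omega) v hvi hvb S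
          hSint ℓ g hloQ hhiQ hFQ hF a hF0 c hci ζ ⟨by linarith [hζI.1], by linarith [hζI.2]⟩ hζv z hzi hzc hzv Nbig mstar
          hLN (by omega) hℓ' hm (fun b hb => by have := hfatX' b hb; linarith) ⟨hlo, hhi⟩
        refine ⟨t, w, htF, hzw, le_trans ?_ h⟩
        calc ((p : ℝ) / (p + q * (1 - p))) ^ (T + 2 * L + 5) * β ^ (d * mstar) * β ^ (d * mstar)
            ≤ ((p : ℝ) / (p + q * (1 - p))) ^ 1 * β ^ (d * mstar) * β ^ 0 :=
              laneBound_le hπ0 hπ1 hβ0 hβ1 (by omega) le_rfl (Nat.zero_le _)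
          _ = _ := by rw [pow_one, pow_zero, mul_one]
      · -- case Y-column through the face `(a, +1)`
        have haiτ : a = i → (1 : ℤ) = -σ := by
          intro hai
          rcases hface with ⟨hσ, hy⟩ | ⟨hσ, hy⟩
          · exfalso
            have h0 := hnotO1.1 hσ
            rw [← hai] at h0 hvi hy
            have : (ℓ : ℤ) * g.hiF a ≤ 0 := mul_nonpos_of_nonneg_of_nonpos hℓ0 h0
            have hFF : (ℓ : ℤ) * g.loF a ≤ ℓ * g.hiF a := mul_le_mul_of_nonneg_left (hF a) hℓ0
            have hT0 : (0 : ℤ) ≤ T := Nat.cast_nonneg T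
            rw [hy, hσ] at hvi
            have : ca ≤ Hi a - M - 1 := by rw [hca_def, hvi]; linarith
            linarith
          · rw [hσ]; norm_num
        obtain ⟨t, w, htF, hzw, h⟩ := lane_caseYcol hq p hd hβ0 hβ1 hβ Lo Hi i σ yi hface M₀ M T G hM₀ hGM v hvi
          hvb S hS hSint ℓ g hloQ hhiQ hFQ hF a hF0 hF1 c hci hca ζ hζI hζv z hzi hzc hzv Nbig mstar hLN hm3 hℓ' hm hfatX'
          1 (Hi a) (Or.inl ⟨rfl, rfl⟩) haiτ (by rw [one_mul]; linarith) (hgate a (Or.inr rfl) 1 (Hi a) (Or.inl ⟨rfl, rfl⟩))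
        exact ⟨t, w, htF, hzw, h⟩
    · -- case Y-column through the face `(a, -1)`
      have haiτ : a = i → (-1 : ℤ) = -σ := by
        intro hai
        rcases hface with ⟨hσ, hy⟩ | ⟨hσ, hy⟩
        · rw [hσ]
        · exfalso
          have h0 := hnotO1.2 hσ
          rw [← hai] at h0 hvi hy
          have : 0 ≤ (ℓ : ℤ) * g.loF a := mul_nonneg hℓ0 h0
          have hT0 : (0 : ℤ) ≤ T := Nat.cast_nonneg T
          rw [hy, hσ] at hvi
          have : Lo a + M + 1 ≤ ca := by rw [hca_def, hvi]; linarith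
          linarith
      obtain ⟨t, w, htF, hzw, h⟩ := lane_caseYcol hq p hd hβ0 hβ1 hβ Lo Hi i σ yi hface M₀ M T G hM₀ hGM v hvi
        hvb S hS hSint ℓ g hloQ hhiQ hFQ hF a hF0 hF1 c hci hca ζ hζI hζv z hzi hzc hzv Nbig mstar hLN hm3 hℓ' hm hfatX'
        (-1) (Lo a) (Or.inr ⟨rfl, rfl⟩) haiτ (by linarith) (hgate a (Or.inr rfl) (-1) (Lo a) (Or.inr ⟨rfl, rfl⟩))
      exact ⟨t, w, htF, hzw, h⟩

end Summit.CriticalPhenomena.PercolationContinuityZ3.Theorems.FK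

end
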